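import Literature.Computability.Complexity.CircuitComposition
import Mathlib.Tactic.Positivity
import Mathlib.Tactic.Linarith
import Mathlib.Algebra.Order.BigOperators.Group.Finset
import Mathlib.Data.Fintype.BigOperators
import HarnessLib

/-!
# Counting the functions computed by small `B₂`-circuits

The counting behind every "union bound over all small circuits" (and behind Shannon's lower
bound): the Boolean functions on `n` inputs computed by `B₂`-circuits with at most `s` gates are at
most `(s+1) · (16 (n+s+1)²)ˢ · (n+s+1)`, via an explicit finite type of circuit codes
(`GateCode`: arity `≤ 2`, truth table, two wires into the `n` inputs or the first `s` gates;
`Code`: at most `s` gate codes and an output wire) and `exists_code` (every small `B₂`-circuit is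
the decoding of a code, by the acyclicity field of `Circuit`). Used for Impagliazzo's hard-core SET
(Goldreich–Nisan–Wigderson, *On Yao's XOR-Lemma*, App. A, Claim 12.3: "the set of all
`2^{s'(O(1) + 2 log₂ s')}` possible circuits of size `s'`").

* `decode`, `exists_code`, `card_computable_le` (by the codes), `card_gateCode_le`,
  `card_code_le`, **`card_computable_le'`**.

## References

* S. Arora, B. Barak, *Computational Complexity: A Modern Approach*, CUP 2009, Thm. 6.21 (proof:
  counting circuits of size `S` by `O(S log S)`-bit descriptions) [AroraBarakCC2009].
-/

namespace Literature.Computability.Complexity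

open Finset GateList

namespace CircuitCount

variable {n s : ℕ}

/-- **A gate code**: an arity `k ≤ 2`, a truth table, and `k` wires into the `n` inputs or the
first `s` gates. [folklore] -/
abbrev GateCode (n s : ℕ) : Type := Σ k : Fin 3, ((Fin k → Bool) → Bool) × (Fin k → Fin n ⊕ Fin s)

/-- **A circuit code**: at most `s` gate codes and an output wire (inputs, gates, or junk). [folklore] -/
abbrev Code (n s : ℕ) : Type := (Σ j : Fin (s + 1), (Fin j → GateCode n s)) × (Fin n ⊕ Fin s ⊕ Unit)

/-- Decoding a wire code. [folklore] -/
def decodeWire (w : Fin n ⊕ Fin s) : Fin n ⊕ ℕ :=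
  match w with
  | .inl i => .inl i
  | .inr m => .inr m

/-- Encoding a wire whose gate index (if any) is below `s`. [folklore] -/
def encodeWire (w : Fin n ⊕ ℕ) (h : ∀ m, w = .inr m → m < s) : Fin n ⊕ Fin s :=
  match w, h with
  | .inl i, _ => .inl i
  | .inr m, h => .inr ⟨m, h m rfl⟩

/-- Decoding inverts encoding of wires. [folklore] -/
theorem decodeWire_encodeWire (w : Fin n ⊕ ℕ) (h : ∀ m, w = .inr m → m < s) : decodeWire (encodeWire w h) = w := by
  cases w <;> rfl

/-- Decoding a gate code to a gate. [folklore] -/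
def decodeGate (c : GateCode n s) : Gate (Fin n) where
  arity := c.1
  op := c.2.1
  args a := decodeWire (c.2.2 a)

/-- Decoding an output wire (junk reads input-free `inr s`, out of range). [folklore] -/
def decodeOut (o : Fin n ⊕ Fin s ⊕ Unit) : Fin n ⊕ ℕ :=
  match o with
  | .inl i => .inl i
  | .inr (.inl m) => .inr m
  | .inr (.inr _) => .inr s

/-- The function of a gate list and an output wire (the evaluation of `Circuit.eval`, without the
well-formedness fields). [folklore] -/
def evalOf (gs : List (Gate (Fin n))) (out : Fin n ⊕ ℕ) (x : Fin n → Bool) : Bool :=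
  match out with
  | .inl i => x i
  | .inr m => (vals gs x).getD m false

/-- `Circuit.eval` is `evalOf` of the gates and the output. [folklore] -/
theorem eval_eq_evalOf (C : Circuit (Fin n)) : C.eval = evalOf C.gates C.output := by
  funext x
  rw [Circuit.eval, circuit_wireVals]
  unfold evalOf
  cases C.output <;> rfl

/-- **The function of a code.** [folklore] -/
def decode (c : Code n s) : (Fin n → Bool) → Bool :=
  evalOf (List.ofFn fun i : Fin c.1.1 => decodeGate (c.1.2 i)) (decodeOut c.2)

/-- Encoding a gate of arity `≤ 2` whose gate wires point below `s`. [folklore] -/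
def encodeGate (g : Gate (Fin n)) (hk : g.arity < 3) (hw : ∀ a m, g.args a = .inr m → m < s) : GateCode n s :=
  ⟨⟨g.arity, hk⟩, g.op, fun a => encodeWire (g.args a) (hw a)⟩

/-- Decoding inverts encoding. [folklore] -/
theorem decodeGate_encodeGate (g : Gate (Fin n)) (hk : g.arity < 3) (hw : ∀ a m, g.args a = .inr m → m < s) :
    decodeGate (encodeGate g hk hw) = g := by
  obtain ⟨k, op, args⟩ := g
  unfold encodeGate decodeGate
  simp only [decodeWire_encodeWire]

/-- **Every small `B₂`-circuit is the decoding of some code.** [folklore] -/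
theorem exists_code (C : Circuit (Fin n)) (hB : C.IsOver B2) (hs : C.size ≤ s) : ∃ c : Code n s, decode c = C.eval := by
  have hs' : C.gates.length ≤ s := hs
  -- encode the gates
  have hk : ∀ j (h : j < C.gates.length), (C.gates[j]).arity < 3 := fun j h => by
    have := hB _ (List.getElem_mem h)
    simp only [B2, Set.mem_setOf_eq, Gate.fn] at this
    omega
  have hw : ∀ (j : ℕ) (h : j < C.gates.length) (a : Fin (C.gates[j]).arity) (m : ℕ), (C.gates[j]).args a = .inr m → m < s :=
    fun j h a m ham => lt_of_lt_of_le ((C.wf j h a m ham).trans h) hs'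
  let gc : Fin C.gates.length → GateCode n s := fun j => encodeGate (C.gates[j]) (hk j j.isLt) (hw j j.isLt)
  -- encode the output
  let oc : Fin n ⊕ Fin s ⊕ Unit := match h : C.output with
    | .inl i => .inl i
    | .inr m => .inr (.inl ⟨m, lt_of_lt_of_le (C.wf_output m h) hs'⟩)
  refine ⟨⟨⟨⟨C.gates.length, Nat.lt_succ_of_le hs'⟩, gc⟩, oc⟩, ?_⟩
  rw [eval_eq_evalOf, decode]
  have hgates : (List.ofFn fun i : Fin C.gates.length => decodeGate (gc i)) = C.gates := by
    apply List.ext_getElem (by simp)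
    intro i h1 h2
    rw [List.getElem_ofFn]
    exact decodeGate_encodeGate _ _ _
  have hout : decodeOut oc = C.output := by
    simp only [oc]
    split
    · next i h => simp [decodeOut, h]
    · next m h => simp [decodeOut, h]
  rw [hgates, hout]

open scoped Classical in
/-- **The number of functions computed by `B₂`-circuits of size `≤ s` on `n` inputs is at most
the number of codes.** [folklore] -/
theorem card_computable_le (n s : ℕ) :
    (Finset.univ.filter fun f : (Fin n → Bool) → Bool =>
      ∃ C : Circuit (Fin n), C.IsOver B2 ∧ C.size ≤ s ∧ ∀ x, C.eval x = f x).card ≤ Fintype.card (Code n s) := by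
  classical
  calc (Finset.univ.filter fun f : (Fin n → Bool) → Bool =>
        ∃ C : Circuit (Fin n), C.IsOver B2 ∧ C.size ≤ s ∧ ∀ x, C.eval x = f x).card
      ≤ (Finset.univ.image (decode (n := n) (s := s))).card := card_le_card fun f hf => by
        obtain ⟨C, hB, hs, hC⟩ := (mem_filter.1 hf).2
        obtain ⟨c, hc⟩ := exists_code C hB hs
        exact mem_image.2 ⟨c, mem_univ _, by rw [hc]; funext x; exact hC x⟩
    _ ≤ Fintype.card (Code n s) := card_image_le.trans (by rw [card_univ])

/-- Gate codes are few: `#GateCode ≤ 16 (n+s+1)²`. [folklore] -/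
theorem card_gateCode_le (n s : ℕ) : Fintype.card (GateCode n s) ≤ 16 * (n + s + 1) ^ 2 := by
  rw [Fintype.card_sigma]
  simp only [Fintype.card_prod, Fintype.card_fun, Fintype.card_bool, Fintype.card_fin, Fintype.card_sum]
  rw [Fin.sum_univ_three]
  simp only [Fin.val_zero, Fin.val_one, Fin.val_two, pow_zero, pow_one]
  norm_num
  nlinarith [Nat.zero_le (n + s)]

/-- **Circuit codes are few**: `#Code ≤ (s+1) (16 (n+s+1)²)ˢ (n+s+1)`. [folklore] -/
theorem card_code_le (n s : ℕ) : Fintype.card (Code n s) ≤ (s + 1) * (16 * (n + s + 1) ^ 2) ^ s * (n + s + 1) := by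
  rw [Fintype.card_prod, Fintype.card_sigma]
  simp only [Fintype.card_fun, Fintype.card_fin, Fintype.card_sum, Fintype.card_unit]
  have h1 : ∑ j : Fin (s + 1), Fintype.card (GateCode n s) ^ (j : ℕ) ≤ (s + 1) * (16 * (n + s + 1) ^ 2) ^ s := by
    calc ∑ j : Fin (s + 1), Fintype.card (GateCode n s) ^ (j : ℕ)
        ≤ ∑ _j : Fin (s + 1), (16 * (n + s + 1) ^ 2) ^ s := Finset.sum_le_sum fun j _ => by
          calc Fintype.card (GateCode n s) ^ (j : ℕ) ≤ (16 * (n + s + 1) ^ 2) ^ (j : ℕ) :=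
                Nat.pow_le_pow_left (card_gateCode_le n s) _
            _ ≤ (16 * (n + s + 1) ^ 2) ^ s := Nat.pow_le_pow_right (by positivity) (Nat.lt_succ_iff.1 j.isLt)
      _ = (s + 1) * (16 * (n + s + 1) ^ 2) ^ s := by simp
  rw [show n + (s + 1) = n + s + 1 by omega]
  exact Nat.mul_le_mul h1 le_rfl

open scoped Classical in
/-- **At most `(s+1)(16(n+s+1)²)ˢ(n+s+1)` Boolean functions on `n` inputs have `B₂`-circuits of
size `≤ s`** (the counting behind Shannon's lower bound; here for union bounds over all small
circuits). [cite: AroraBarakCC2009, Thm. 6.21 (proof: counting circuits)] -/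
theorem card_computable_le' (n s : ℕ) :
    (Finset.univ.filter fun f : (Fin n → Bool) → Bool =>
      ∃ C : Circuit (Fin n), C.IsOver B2 ∧ C.size ≤ s ∧ ∀ x, C.eval x = f x).card ≤
      (s + 1) * (16 * (n + s + 1) ^ 2) ^ s * (n + s + 1) :=
  (card_computable_le n s).trans (card_code_le n s)

end CircuitCount

end Literature.Computability.Complexity
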